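import Literature.AlgebraicGeometry.Deformation.LiftOfCoboundary
import Literature.AlgebraicGeometry.Deformation.ObstructionCocycle
import Literature.AlgebraicGeometry.Modules.CechThetaVanishingClosed
import HarnessLib

/-!
# If the Čech obstruction class vanishes, the framed module lifts

Setting of `Deformation/DefectCochain.lean` / `Deformation/ObstructionCocycle.lean` /
`Deformation/LiftOfCoboundary.lean`: `j : Y ⟶ Z₀` a closed immersion, `i : Z₀ ⟶ Z₁` a first-order
thickening, `eI : i_* j_* 𝒪_Y ≅ 𝓘 = Ker(i♯)`, an `𝒪_{Z₀}`-module `F` with `j^*F` finite locally free,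
a frame cover `C = (U_a, I_a, e_a)` of `F` by AFFINE opens `U_a ⊆ Z₁` covering `Z₁`, with centres
`x_a ∈ U_a` hitting every point of `Y` (e.g. point-indexed covers), and lifts `L = (T̃_{ab})`.

* `FrameCover.Lifts.exists_lift_of_classOf_eq_zero` — **if the `Ext`-class
  `[ω] ∈ Ext²(j^*F, j^*F)` of the obstruction cocycle `ω = toLocalFamily κ(c)` vanishes, then
  `F ≅ i^*F'` for a finite locally free `𝒪_{Z₁}`-module `F'`.**

Proof = the two halves already in the tree: a cocycle of local endomorphisms of the finite locally
free `j^*F` with vanishing class is a coboundary on the refinement of the cover by basic opens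
`D(f_a) ∋ x_a` (`Cech.exists_basicOpen_refinement_eq_dFamily_of_centres`,
`Modules/CechThetaVanishingClosed.lean` — the "kernel" half, Čech → `Ext`), and a framed module whose
obstruction cocycle is a coboundary on a refinement of `𝓤^Y` lifts
(`exists_lift_of_restrictFamily_eq_dFamily`, `Deformation/LiftOfCoboundary.lean` — corrected lifts
and gluing). This is the existence half of Hartshorne, *Deformation Theory*, Thm. 7.1 in the
`Ext`-valued form of the tree. Everything is proved; no named facts.

## References

* R. Hartshorne, *Deformation Theory*, GTM 257 (2010), §7, Thm. 7.1. [Hartshorne2010]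
* R. Hartshorne, *Algebraic Geometry*, GTM 52 (1977), III Lemma 4.4. [Hartshorne1977]
-/

noncomputable section

open CategoryTheory CategoryTheory.Abelian AlgebraicGeometry Opposite TopologicalSpace Limits

namespace Literature.AlgebraicGeometry.Deformation

open Literature.AlgebraicGeometry.Modules Literature.AlgebraicGeometry.Motives

universe u

variable {Y Z₀ Z₁ : Scheme.{u}} {j : Y ⟶ Z₀} {i : Z₀ ⟶ Z₁} {F : Z₀.Modules} {ι : Type u}

namespace FrameCover.Lifts

variable {C : FrameCover i F ι}
  (eI : (Scheme.Modules.pushforward i).obj ((Scheme.Modules.pushforward j).obj (unitModule Y)) ≅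
    idealModule i)
  (L : C.Lifts) [IsFirstOrderThickening i] [IsClosedImmersion j] [HasExt.{u + 1} Y.Modules]

/-- **Vanishing obstruction class ⇒ lift.** If the frame cover consists of affine opens `U_a`
covering `Z₁` with centres `x_a ∈ U_a` hitting every point of `Y`, `j^*F` is finite locally free
and the `Ext`-class of the obstruction cocycle `toLocalFamily κ(c)` vanishes in `Ext²(j^*F, j^*F)`,
then `F ≅ i^*F'` for a finite locally free `𝒪_{Z₁}`-module `F'`.
[cite: Hartshorne2010, §7, Thm. 7.1] -/
theorem exists_lift_of_classOf_eq_zero (hUaff : ∀ a, IsAffineOpen (C.U a)) (x : ι → Z₁)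
    (hx : ∀ a, x a ∈ C.U a) (hsurj : ∀ y : Y, ∃ a, x a = i (j y))
    (hE : IsFiniteLocallyFree ((Scheme.Modules.pullback j).obj F))
    (hcovY : iSup (C.baseFraming j).U = ⊤)
    (h0 : Cech.classOf (Cech.exactAugmentation (C.baseFraming j).U ((Scheme.Modules.pullback j).obj F) hcovY)
      ((C.baseFraming j).toLocalFamily (L.defectCochain eI))
      ((C.baseFraming j).dFamily_toLocalFamily_eq_zero _ (L.D₂_defectCochain eI)) = 0)
    (hcov : ∀ z : Z₁, ∃ a, z ∈ C.U a) :
    ∃ F' : Z₁.Modules, IsFiniteLocallyFree F' ∧ Nonempty ((Scheme.Modules.pullback i).obj F' ≅ F) := by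
  obtain ⟨φ, hφ, β, hβ⟩ := Cech.exists_basicOpen_refinement_eq_dFamily_of_centres j i C.U hUaff x hx hsurj
    hE ((C.baseFraming j).toLocalFamily (L.defectCochain eI))
    ((C.baseFraming j).dFamily_toLocalFamily_eq_zero _ (L.D₂_defectCochain eI)) hcovY h0
  exact L.exists_lift_of_restrictFamily_eq_dFamily eI
    (fun a => Cech.preimage₂_mono j i (Z₁.basicOpen_le (φ a)))
    (Cech.iSup_preimage₂_eq_top_of_centres j i _ x hφ hsurj) β hβ hcov

/-- The point-indexed case: covers `(U_z)_{z ∈ Z₁}` with `z ∈ U_z`. [cite: Hartshorne2010, §7, Thm. 7.1] -/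
theorem exists_lift_of_classOf_eq_zero_pointIndexed {C : FrameCover i F Z₁} (L : C.Lifts)
    (hUaff : ∀ z, IsAffineOpen (C.U z)) (hU : ∀ z, z ∈ C.U z)
    (hE : IsFiniteLocallyFree ((Scheme.Modules.pullback j).obj F))
    (hcovY : iSup (C.baseFraming j).U = ⊤)
    (h0 : Cech.classOf (Cech.exactAugmentation (C.baseFraming j).U ((Scheme.Modules.pullback j).obj F) hcovY)
      ((C.baseFraming j).toLocalFamily (L.defectCochain eI))
      ((C.baseFraming j).dFamily_toLocalFamily_eq_zero _ (L.D₂_defectCochain eI)) = 0) :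
    ∃ F' : Z₁.Modules, IsFiniteLocallyFree F' ∧ Nonempty ((Scheme.Modules.pullback i).obj F' ≅ F) :=
  L.exists_lift_of_classOf_eq_zero eI hUaff id hU (fun y => ⟨i (j y), rfl⟩) hE hcovY h0
    fun z => ⟨z, hU z⟩

end FrameCover.Lifts

end Literature.AlgebraicGeometry.Deformation

end
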